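import Mathlib.Analysis.SpecificLimits.Normed
import Mathlib.Analysis.SpecialFunctions.Exp
import Mathlib.Logic.Function.DependsOn
import Literature.Computability.Complexity.BooleanFourier
import Literature.Computability.Complexity.SwitchingLemma
import HarnessLib

/-!
# Fourier tails of Boolean functions under random restrictions (Tal 2017, §2–4)

Topic `Literature/Computability/Complexity`. Fourier-analytic lemmas of A. Tal, *Tight bounds on
the Fourier spectrum of AC⁰* (CCC 2017; full version ECCC TR14-174, whose numbering is used), on
top of the cube Fourier expansion of `BooleanFourier.lean` (`cubeFourierCoeff`, O'Donnell 2014) and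
the partial assignments / random restriction `R_p` of `SwitchingLemma.lean` (`PAssign`,
`rrWeight`, block-query processes `procDepth`/`procLeaves`). Everything is proved.

* `levelWeight`, `tailWeight` (`W^k`, `W^{≥k}`), `l1Level` (`L_{1,k}`) [Tal 2017, §2.2, Def. 2.7].
* Restrictions averaged over the fixed values: `ĝ_{V←β}(T) = ∑_{U⊆V} ĝ(T∪U) χ_U(β)`
  (`cubeFourierCoeff_piecewise_eq_sum_powerset`, O'Donnell Prop. 3.21),
  `∑_β ĝ_{V←β}(T)² = 2^m ∑_{U⊆V} ĝ(T∪U)²`, and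
  `2^{-m}∑_β W^{≥k}[g_{V←β}] = ∑_{|S∖V| ≥ k} ĝ(S)²` (`sum_tailWeight_piecewise`).
* **Lemma 3.2/3.3** (Impagliazzo–Kabanets, for blocks and for block-query processes = common
  partial decision trees): `tailWeight_add_card_le`, `tailWeight_add_procDepth_le`.
* Decision trees of depth `D` have no weight above level `D`
  (`cubeFourierCoeff_decisionTree_eq_zero`, `tailWeight_decisionTree_eq_zero`).
* **Lemma 3.1** ([LMN93]) in threshold form (`tailWeight_le_two_mul_sum_rrWeight`): if for every
  `|S| ≥ k` at least `j` variables of `S` stay free with probability `≥ 1/2` then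
  `W^{≥k}[g] ≤ 2 𝔼_ρ W^{≥j}[g|ρ]`; the hypothesis is supplied by Chebyshev
  (`half_le_sum_subsetWeight_free`: `p|S| ≥ 8`, `j ≤ p|S|/2`) in place of the median bound for
  binomials [KB80] quoted by Tal — this only changes constants downstream.
  (`sum_rrWeight_tailWeight` is Cor. 2.6 summed: `𝔼_ρ W^{≥j}[g|ρ] = ∑_S ĝ(S)² Pr[|S ∩ stars| ≥ j]`.)
* **§4, ESFT ⇒ L1** (`l1Level_le_of_tailWeight_le`): for `{±1}`-valued `g`, if
  `W^{≥d}[g] ≤ C e^{-d/τ}` for all `d` then `L_{1,k}(g) ≤ C (2τ)^k` (`k ≥ 1`), through Lemma 4.5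
  (`abs_cubeFourierCoeff_le_pow_mul_sum`: `|ĝ(T)| ≤ 2^{|T|} Inf_T`, by the `2^{-|T|}`-granularity of
  the top coefficient of the restrictions to `T`, `abs_coeff_restrict_le_sq`, summing functions
  that `DependsOn` a block of coordinates), Abel summation
  (Lemma 2.14, `sum_choose_mul_sq_eq_sum_tailWeight`) and the negative-binomial series
  (Cor. 2.2, Mathlib's `hasSum_choose_mul_geometric_of_norm_lt_one`; `eˣ - 1 ≥ x`).

## References

* A. Tal, *Tight bounds on the Fourier spectrum of AC⁰*, CCC 2017 / ECCC TR14-174, §2–4 [Tal2017].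
* N. Linial, Y. Mansour, N. Nisan, *Constant depth circuits, Fourier transform, and learnability*,
  J. ACM 40 (1993), Lemma 7 [LinialMansourNisan1993].
* R. O'Donnell, *Analysis of Boolean Functions*, CUP 2014, §1.2–1.4, Prop. 3.21 [ODonnell2014].
* J. Håstad, *Computational limitations of small-depth circuits*, MIT 1986, §2 (`R_p`) [Hastad1986].
-/

noncomputable section

namespace Literature.Computability.Complexity.LowDegree

open Finset PAssign

variable {m : ℕ}

/-! ### Level weights, tail weights, level `L₁` norms -/

/-- The Fourier weight of `g` at level `k`: `W^k[g] = ∑_{|S|=k} ĝ(S)²` (Tal 2017, §2.2). [cite: Tal2017, §2.2] -/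
def levelWeight (g : (Fin m → Bool) → ℝ) (k : ℕ) : ℝ :=
  ∑ S ∈ univ.powersetCard k, cubeFourierCoeff g S ^ 2

/-- The Fourier tail of `g` above level `k`: `W^{≥k}[g] = ∑_{|S| ≥ k} ĝ(S)²` (Tal 2017, §2.2). [cite: Tal2017, §2.2] -/
def tailWeight (g : (Fin m → Bool) → ℝ) (k : ℕ) : ℝ :=
  ∑ S ∈ univ.filter (fun S : Finset (Fin m) => k ≤ S.card), cubeFourierCoeff g S ^ 2

/-- The spectral norm of level `k`: `L_{1,k}(g) = ∑_{|S|=k} |ĝ(S)|` (Tal 2017, Def. 2.7), for a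
real-valued `g`. This is the real-valued generalisation of `Literature.Computability.QuantumComplexity.fourierL1Level`
of file `Literature/Computability/QuantumComplexity/RazTalForrelation` (the `L_{1,k}` inside the
named fact `Tal2017_fourierL1_ac0`): `fourierL1Level f k = l1Level (fun x => sgn (f x)) k` by `rfl`
(bridge stated in the discharge file importing both); the two should eventually be unified. [cite: Tal2017, Definition 2.7] -/
def l1Level (g : (Fin m → Bool) → ℝ) (k : ℕ) : ℝ :=
  ∑ S ∈ univ.powersetCard k, |cubeFourierCoeff g S|

/-- Tail weights are nonnegative. [folklore] -/
theorem tailWeight_nonneg (g : (Fin m → Bool) → ℝ) (k : ℕ) : 0 ≤ tailWeight g k :=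
  Finset.sum_nonneg fun _ _ => sq_nonneg _

/-- Tail weights decrease with the level. [folklore] -/
theorem tailWeight_antitone (g : (Fin m → Bool) → ℝ) {k k' : ℕ} (h : k ≤ k') : tailWeight g k' ≤ tailWeight g k :=
  Finset.sum_le_sum_of_subset_of_nonneg
    (fun S hS => by simp only [Finset.mem_filter, Finset.mem_univ, true_and] at hS ⊢; omega)
    fun _ _ _ => sq_nonneg _

/-- `W^{≥0}[g] = ∑_S ĝ(S)² = 𝔼 g²` (Parseval). [cite: ODonnell2014, §1.4] -/
theorem tailWeight_zero (g : (Fin m → Bool) → ℝ) : tailWeight g 0 = (∑ x, g x ^ 2) / 2 ^ m := by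
  rw [tailWeight, ← sum_cubeFourierCoeff_sq]
  exact Finset.sum_congr (by ext S; simp) fun _ _ => rfl

/-- For `{±1}`-valued `g`, `W^{≥k}[g] ≤ 1`. [cite: Tal2017, §2.2] -/
theorem tailWeight_le_one {g : (Fin m → Bool) → ℝ} (hg : ∀ x, g x ^ 2 = 1) (k : ℕ) : tailWeight g k ≤ 1 := by
  refine (tailWeight_antitone g (Nat.zero_le k)).trans ?_
  rw [tailWeight_zero]
  simp only [hg, Finset.sum_const, Finset.card_univ, Fintype.card_fun, Fintype.card_bool, Fintype.card_fin,
    nsmul_eq_mul, mul_one, Nat.cast_pow, Nat.cast_ofNat]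
  rw [div_self (by positivity)]

/-- The tail above level `m + 1` vanishes. [folklore] -/
theorem tailWeight_eq_zero_of_lt {g : (Fin m → Bool) → ℝ} {k : ℕ} (hk : m < k) : tailWeight g k = 0 := by
  refine Finset.sum_eq_zero fun S hS => ?_
  simp only [Finset.mem_filter, Finset.mem_univ, true_and] at hS
  have := S.card_le_univ; rw [Fintype.card_fin] at this
  omega

/-! ### Fourier coefficients of restrictions, averaged over the fixed values -/

/-- **Coefficients of a restriction** (O'Donnell Prop. 3.21 in `T, U` form): for `T ∩ V = ∅`,
`ĝ_{V←β}(T) = ∑_{U ⊆ V} ĝ(T ∪ U) χ_U(β)`. [cite: ODonnell2014, Prop. 3.21] -/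
theorem cubeFourierCoeff_piecewise_eq_sum_powerset (g : (Fin m → Bool) → ℝ) (V : Finset (Fin m))
    (β : Fin m → Bool) {T : Finset (Fin m)} (hT : Disjoint T V) :
    cubeFourierCoeff (fun x => g (V.piecewise β x)) T =
      ∑ U ∈ V.powerset, cubeFourierCoeff g (T ∪ U) * Literature.Probability.RandomGraphs.LowDegree.walsh U β := by
  rw [cubeFourierCoeff_piecewise, ← Finset.sum_filter]
  refine Finset.sum_nbij' (fun S => S.filter (· ∈ V)) (fun U => T ∪ U) ?_ ?_ ?_ ?_ ?_
  · intro S _; simp only [Finset.mem_powerset]; intro i hi; exact (Finset.mem_filter.1 hi).2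
  · intro U hU
    simp only [Finset.mem_powerset] at hU
    simp only [Finset.mem_filter, Finset.mem_univ, true_and]
    ext i
    simp only [Finset.mem_filter, Finset.mem_union]
    constructor
    · rintro ⟨h | h, hn⟩
      · exact h
      · exact absurd (hU h) hn
    · intro h; exact ⟨Or.inl h, Finset.disjoint_left.1 hT h⟩
  · intro S hS
    simp only [Finset.mem_filter, Finset.mem_univ, true_and] at hS
    rw [← hS, Finset.union_comm]
    exact Finset.filter_union_filter_not_eq _ S
  · intro U hU
    simp only [Finset.mem_powerset] at hU
    ext i
    simp only [Finset.mem_filter, Finset.mem_union]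
    constructor
    · rintro ⟨h | h, hi⟩
      · exact absurd hi (Finset.disjoint_left.1 hT h)
      · exact h
    · intro h; exact ⟨Or.inr h, hU h⟩
  · intro S hS
    simp only [Finset.mem_filter, Finset.mem_univ, true_and] at hS
    simp only [Literature.Probability.RandomGraphs.LowDegree.walsh]
    congr 1
    rw [← hS, Finset.union_comm, Finset.filter_union_filter_not_eq]

/-- **Averaging the squared coefficients of a restriction over the fixed values**:
`∑_β ĝ_{V←β}(T)² = 2^m ∑_{U ⊆ V} ĝ(T ∪ U)²` for `T ∩ V = ∅`. [cite: ODonnell2014, Prop. 3.21] -/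
theorem sum_sq_cubeFourierCoeff_piecewise (g : (Fin m → Bool) → ℝ) (V : Finset (Fin m))
    {T : Finset (Fin m)} (hT : Disjoint T V) :
    ∑ β : Fin m → Bool, cubeFourierCoeff (fun x => g (V.piecewise β x)) T ^ 2 =
      2 ^ m * ∑ U ∈ V.powerset, cubeFourierCoeff g (T ∪ U) ^ 2 := by
  simp_rw [cubeFourierCoeff_piecewise_eq_sum_powerset g V _ hT, sq, Finset.sum_mul_sum]
  rw [Finset.sum_comm]
  simp_rw [Finset.sum_comm (s := (Finset.univ : Finset (Fin m → Bool))) (t := V.powerset)]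
  rw [Finset.mul_sum]
  refine Finset.sum_congr rfl fun U hU => ?_
  have e : ∀ U' ∈ V.powerset, ∑ β : Fin m → Bool,
      cubeFourierCoeff g (T ∪ U) * Literature.Probability.RandomGraphs.LowDegree.walsh U β * (cubeFourierCoeff g (T ∪ U') * Literature.Probability.RandomGraphs.LowDegree.walsh U' β) =
      cubeFourierCoeff g (T ∪ U) * cubeFourierCoeff g (T ∪ U') * ∑ β : Fin m → Bool, Literature.Probability.RandomGraphs.LowDegree.walsh U β * Literature.Probability.RandomGraphs.LowDegree.walsh U' β := by
    intro U' _
    rw [Finset.mul_sum]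
    exact Finset.sum_congr rfl fun β _ => by ring
  rw [Finset.sum_congr rfl e]
  simp_rw [sum_walsh_mul_walsh_index]
  simp only [mul_ite, mul_zero]
  rw [Finset.sum_ite_eq]
  simp [hU]
  ring

/-- Every subset is the disjoint union of its parts off and in `V`: reindexing sums over all
subsets by pairs `(T, U)` with `T ∩ V = ∅`, `U ⊆ V`. [folklore] -/
theorem sum_eq_sum_disjoint_sum_powerset (V : Finset (Fin m)) (F : Finset (Fin m) → ℝ) :
    ∑ S, F S = ∑ T ∈ univ.filter (fun T : Finset (Fin m) => Disjoint T V), ∑ U ∈ V.powerset, F (T ∪ U) := by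
  rw [← Finset.sum_product']
  symm
  refine Finset.sum_nbij' (fun q => q.1 ∪ q.2) (fun S => (S.filter (· ∉ V), S.filter (· ∈ V))) ?_ ?_ ?_ ?_ ?_
  · intro q _; exact Finset.mem_univ _
  · intro S _
    simp only [Finset.mem_product, Finset.mem_filter, Finset.mem_univ, true_and, Finset.mem_powerset]
    exact ⟨Finset.disjoint_left.2 fun i hi => (Finset.mem_filter.1 hi).2, fun i hi => (Finset.mem_filter.1 hi).2⟩
  · intro q hq
    simp only [Finset.mem_product, Finset.mem_filter, Finset.mem_univ, true_and, Finset.mem_powerset] at hq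
    obtain ⟨h1, h2⟩ := hq
    ext <;> simp only [Finset.mem_filter, Finset.mem_union]
    · constructor
      · rintro ⟨h | h, hn⟩
        · exact h
        · exact absurd (h2 h) hn
      · intro h; exact ⟨Or.inl h, Finset.disjoint_left.1 h1 h⟩
    · constructor
      · rintro ⟨h | h, hi⟩
        · exact absurd hi (Finset.disjoint_left.1 h1 h)
        · exact h
      · intro h; exact ⟨Or.inr h, h2 h⟩
  · intro S _
    rw [Finset.union_comm]; exact Finset.filter_union_filter_not_eq _ S
  · intro q _; rfl

/-- **Average tail weight of restrictions**: `2^{-m} ∑_β W^{≥k}[g_{V←β}] = ∑_{S : |S ∖ V| ≥ k} ĝ(S)²`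
(Tal 2017, proof of Lemma 3.2, summed over a block; O'Donnell Prop. 3.21 + Parseval in `β`). [cite: Tal2017, Lemma 3.2] -/
theorem sum_tailWeight_piecewise (g : (Fin m → Bool) → ℝ) (V : Finset (Fin m)) (k : ℕ) :
    ∑ β : Fin m → Bool, tailWeight (fun x => g (V.piecewise β x)) k =
      2 ^ m * ∑ S ∈ univ.filter (fun S : Finset (Fin m) => k ≤ (S \ V).card), cubeFourierCoeff g S ^ 2 := by
  unfold tailWeight
  rw [Finset.sum_comm]
  -- split `T` according to whether it meets `V`
  have hsplit : ∀ T ∈ univ.filter (fun S : Finset (Fin m) => k ≤ S.card),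
      ∑ β : Fin m → Bool, cubeFourierCoeff (fun x => g (V.piecewise β x)) T ^ 2 =
        if Disjoint T V then 2 ^ m * ∑ U ∈ V.powerset, cubeFourierCoeff g (T ∪ U) ^ 2 else 0 := by
    intro T _
    split_ifs with hTV
    · exact sum_sq_cubeFourierCoeff_piecewise g V hTV
    · refine Finset.sum_eq_zero fun β _ => ?_
      rw [cubeFourierCoeff_piecewise_eq_zero, zero_pow two_ne_zero]
      rw [Finset.not_disjoint_iff] at hTV
      obtain ⟨i, hi, hiV⟩ := hTV
      exact ⟨i, hi, hiV⟩
  rw [Finset.sum_congr rfl hsplit, ← Finset.sum_filter, Finset.filter_filter]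
  -- the right-hand side, reindexed by `(T, U)`
  have hR : ∑ S ∈ univ.filter (fun S : Finset (Fin m) => k ≤ (S \ V).card), cubeFourierCoeff g S ^ 2 =
      ∑ T ∈ univ.filter (fun T : Finset (Fin m) => k ≤ T.card ∧ Disjoint T V),
        ∑ U ∈ V.powerset, cubeFourierCoeff g (T ∪ U) ^ 2 := by
    rw [Finset.sum_filter, sum_eq_sum_disjoint_sum_powerset V]
    have hswap : univ.filter (fun T : Finset (Fin m) => k ≤ T.card ∧ Disjoint T V) =
        (univ.filter (fun T : Finset (Fin m) => Disjoint T V)).filter (fun T => k ≤ T.card) := by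
      ext T; simp [and_comm]
    rw [hswap]
    conv_rhs => rw [Finset.sum_filter]
    refine Finset.sum_congr rfl fun T hT => ?_
    simp only [Finset.mem_filter, Finset.mem_univ, true_and] at hT
    have hcond : ∀ U ∈ V.powerset, ((T ∪ U) \ V).card = T.card := by
      intro U hU
      rw [Finset.mem_powerset] at hU
      rw [Finset.union_sdiff_distrib, Finset.sdiff_eq_self_of_disjoint hT,
        Finset.sdiff_eq_empty_iff_subset.2 hU, Finset.union_empty]
    split_ifs with hk
    · exact Finset.sum_congr rfl fun U hU => by rw [if_pos (by rw [hcond U hU]; exact hk)]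
    · exact Finset.sum_eq_zero fun U hU => by rw [if_neg (by rw [hcond U hU]; exact hk)]
  rw [hR, Finset.mul_sum]

/-! ### Fixing a block of variables costs at most its size in the tail level (Tal, Lemmas 3.2–3.3) -/

/-- **Tal 2017, Lemma 3.2 for a block** (after Impagliazzo–Kabanets): `W^{≥k+|V|}[g]` is at most
the average over `β` of `W^{≥k}[g_{V←β}]`; in particular if every `W^{≥k}[g_{V←β}] ≤ ε` then
`W^{≥k+|V|}[g] ≤ ε`. [cite: Tal2017, Lemma 3.2] -/
theorem tailWeight_add_card_le {g : (Fin m → Bool) → ℝ} {V : Finset (Fin m)} {k : ℕ} {ε : ℝ}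
    (h : ∀ β : Fin m → Bool, tailWeight (fun x => g (V.piecewise β x)) k ≤ ε) :
    tailWeight g (k + V.card) ≤ ε := by
  have hsum := sum_tailWeight_piecewise g V k
  have hle : tailWeight g (k + V.card) ≤
      ∑ S ∈ univ.filter (fun S : Finset (Fin m) => k ≤ (S \ V).card), cubeFourierCoeff g S ^ 2 := by
    refine Finset.sum_le_sum_of_subset_of_nonneg (fun S hS => ?_) fun _ _ _ => sq_nonneg _
    simp only [Finset.mem_filter, Finset.mem_univ, true_and] at hS ⊢
    have := Finset.le_card_sdiff V S
    omega
  refine hle.trans ?_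
  have h2 : (0 : ℝ) < 2 ^ m := by positivity
  have : ∑ S ∈ univ.filter (fun S : Finset (Fin m) => k ≤ (S \ V).card), cubeFourierCoeff g S ^ 2 =
      (∑ β : Fin m → Bool, tailWeight (fun x => g (V.piecewise β x)) k) / 2 ^ m := by
    rw [hsum]; field_simp
  rw [this, div_le_iff₀ h2]
  calc ∑ β : Fin m → Bool, tailWeight (fun x => g (V.piecewise β x)) k ≤ ∑ _β : Fin m → Bool, ε :=
        Finset.sum_le_sum fun β _ => h β
    _ = ε * 2 ^ m := by simp [Finset.card_univ]; ring

/-- **Tal 2017, Lemma 3.3 for block-query processes** (common partial decision trees): if at every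
leaf `τ` of an adaptive process querying blocks of free variables `W^{≥k}[g|τ] ≤ ε`, then
`W^{≥k+D}[g|σ] ≤ ε` where `D` is the depth of the process from `σ`. [cite: Tal2017, Lemma 3.3] -/
theorem tailWeight_add_procDepth_le {Q : PAssign m → Finset (Fin m)} (hQ : ∀ σ, Q σ ⊆ σ.free)
    (g : (Fin m → Bool) → ℝ) (k : ℕ) {ε : ℝ} :
    ∀ (fuel : ℕ) (σ : PAssign m), (∀ τ ∈ procLeaves Q fuel σ, tailWeight (fun x => g (τ.apply x)) k ≤ ε) →
      tailWeight (fun x => g (σ.apply x)) (k + procDepth Q fuel σ) ≤ ε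
  | 0, σ, h => by simpa [procDepth, procLeaves] using h
  | fuel + 1, σ, h => by
    unfold procDepth
    simp only [procLeaves] at h
    split_ifs at h ⊢ with hQe
    · simpa using h
    · set V := Q σ with hV
      set s := univ.sup fun b : Fin m → Bool => procDepth Q fuel (σ.fix V b) with hs
      rw [show k + (V.card + s) = (k + s) + V.card by ring]
      refine tailWeight_add_card_le fun β => ?_
      have happ : (fun x => g (σ.apply (V.piecewise β x))) = fun x => g ((σ.fix V β).apply x) := by
        funext x; rw [fix_apply (hQ σ)]
      rw [happ]
      have hd : procDepth Q fuel (σ.fix V β) ≤ s := Finset.le_sup (f := fun b : Fin m → Bool =>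
        procDepth Q fuel (σ.fix V b)) (Finset.mem_univ β)
      refine (tailWeight_antitone _ (by omega : k + procDepth Q fuel (σ.fix V β) ≤ k + s)).trans ?_
      refine tailWeight_add_procDepth_le hQ g k fuel (σ.fix V β) fun τ hτ => h τ ?_
      simp only [Finset.mem_biUnion, Finset.mem_univ, true_and]
      exact ⟨β, hτ⟩

/-! ### Decision trees have no Fourier weight above their depth -/

/-- Multiplying by the character of one coordinate shifts coefficients by symmetric difference:
`(χ_i h)^(S) = ĥ(S ∆ {i})`. [cite: ODonnell2014, §1.2] -/
theorem cubeFourierCoeff_sgn_mul (h : (Fin m → Bool) → ℝ) (i : Fin m) (S : Finset (Fin m)) :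
    cubeFourierCoeff (fun x => Literature.Probability.RandomGraphs.LowDegree.sgn (x i) * h x) S = cubeFourierCoeff h (symmDiff S {i}) := by
  unfold cubeFourierCoeff
  congr 1
  refine Finset.sum_congr rfl fun x _ => ?_
  have : Literature.Probability.RandomGraphs.LowDegree.walsh (symmDiff S {i}) x = Literature.Probability.RandomGraphs.LowDegree.sgn (x i) * Literature.Probability.RandomGraphs.LowDegree.walsh S x := by
    by_cases hi : i ∈ S
    · have e : symmDiff S {i} = S.erase i := by
        ext j; simp only [Finset.mem_symmDiff, Finset.mem_singleton, Finset.mem_erase]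
        constructor
        · rintro (⟨h1, h2⟩ | ⟨rfl, h2⟩)
          · exact ⟨h2, h1⟩
          · exact absurd hi h2
        · rintro ⟨h1, h2⟩; exact Or.inl ⟨h2, h1⟩
      rw [e, Literature.Probability.RandomGraphs.LowDegree.walsh, Literature.Probability.RandomGraphs.LowDegree.walsh, ← Finset.mul_prod_erase S (fun j => Literature.Probability.RandomGraphs.LowDegree.sgn (x j)) hi]
      rw [← mul_assoc, Literature.Probability.RandomGraphs.LowDegree.sgn_mul_self, one_mul]
    · have e : symmDiff S {i} = insert i S := by
        ext j; simp only [Finset.mem_symmDiff, Finset.mem_singleton, Finset.mem_insert]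
        constructor
        · rintro (⟨h1, _⟩ | ⟨rfl, _⟩)
          · exact Or.inr h1
          · exact Or.inl rfl
        · rintro (rfl | h1)
          · exact Or.inr ⟨rfl, hi⟩
          · exact Or.inl ⟨h1, fun h => hi (h ▸ h1)⟩
      rw [e, Literature.Probability.RandomGraphs.LowDegree.walsh, Literature.Probability.RandomGraphs.LowDegree.walsh, Finset.prod_insert hi]
  rw [this]; ring

/-- A constant has no Fourier coefficient at a nonempty set. [cite: ODonnell2014, §1.2] -/
theorem cubeFourierCoeff_const {c : ℝ} {S : Finset (Fin m)} (hS : S ≠ ∅) :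
    cubeFourierCoeff (fun _ : Fin m → Bool => c) S = 0 := by
  unfold cubeFourierCoeff
  rw [← Finset.mul_sum]
  have := sum_walsh_mul_walsh_index S (∅ : Finset (Fin m))
  simp only [Literature.Probability.RandomGraphs.LowDegree.walsh_empty, mul_one, if_neg hS] at this
  rw [this]; simp

/-- Coefficients are additive. [cite: ODonnell2014, §1.2] -/
theorem cubeFourierCoeff_add (a b : (Fin m → Bool) → ℝ) (S : Finset (Fin m)) :
    cubeFourierCoeff (fun x => a x + b x) S = cubeFourierCoeff a S + cubeFourierCoeff b S := by
  unfold cubeFourierCoeff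
  rw [← add_div, ← Finset.sum_add_distrib]
  congr 1
  exact Finset.sum_congr rfl fun x _ => by ring

/-- Coefficients are subtractive. [cite: ODonnell2014, §1.2] -/
theorem cubeFourierCoeff_sub (a b : (Fin m → Bool) → ℝ) (S : Finset (Fin m)) :
    cubeFourierCoeff (fun x => a x - b x) S = cubeFourierCoeff a S - cubeFourierCoeff b S := by
  unfold cubeFourierCoeff
  rw [← sub_div, ← Finset.sum_sub_distrib]
  congr 1
  exact Finset.sum_congr rfl fun x _ => by ring

/-- Coefficients are homogeneous. [cite: ODonnell2014, §1.2] -/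
theorem cubeFourierCoeff_const_mul (c : ℝ) (a : (Fin m → Bool) → ℝ) (S : Finset (Fin m)) :
    cubeFourierCoeff (fun x => c * a x) S = c * cubeFourierCoeff a S := by
  unfold cubeFourierCoeff
  rw [mul_div_assoc', Finset.mul_sum]
  congr 1
  exact Finset.sum_congr rfl fun x _ => by ring

/-- **Decision trees of depth `D` have Fourier degree `≤ D`**: every coefficient of (a real reading
of) a decision tree at a set larger than its depth vanishes (Tal 2017, §3: "expressed as a decision
tree of depth ≤ ℓ, hence degree ≤ ℓ"). [cite: Tal2017, §3] -/
theorem cubeFourierCoeff_decisionTree_eq_zero (φ : Bool → ℝ) :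
    ∀ (T : DecisionTree m) (S : Finset (Fin m)), T.depth < S.card →
      cubeFourierCoeff (fun x => φ (T.eval x)) S = 0
  | .leaf b, S, hS => by
    have hne : S ≠ ∅ := by rintro rfl; simp at hS
    show cubeFourierCoeff (fun _ => φ b) S = 0
    exact cubeFourierCoeff_const hne
  | .query i t₀ t₁, S, hS => by
    simp only [DecisionTree.depth] at hS
    have hrepr : (fun x => φ ((DecisionTree.query i t₀ t₁).eval x)) =
        fun x => ((1 : ℝ) / 2) * (φ (t₀.eval x) + φ (t₁.eval x)) +
          ((1 : ℝ) / 2) * (Literature.Probability.RandomGraphs.LowDegree.sgn (x i) * (φ (t₀.eval x) - φ (t₁.eval x))) := by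
      funext x
      simp only [DecisionTree.eval]
      cases x i <;> simp [Literature.Probability.RandomGraphs.LowDegree.sgn] <;> ring
    rw [hrepr, cubeFourierCoeff_add, cubeFourierCoeff_const_mul, cubeFourierCoeff_const_mul, cubeFourierCoeff_add,
      cubeFourierCoeff_sgn_mul, cubeFourierCoeff_sub]
    have h0 : t₀.depth < S.card := by omega
    have h1 : t₁.depth < S.card := by omega
    have hcard : S.card ≤ (symmDiff S {i}).card + 1 := by
      have : S ⊆ symmDiff S {i} ∪ {i} := by
        intro j hj
        by_cases hji : j = i
        · subst hji; simp
        · exact Finset.mem_union_left _ (Finset.mem_symmDiff.2 (Or.inl ⟨hj, by simpa using hji⟩))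
      calc S.card ≤ (symmDiff S {i} ∪ {i}).card := Finset.card_le_card this
        _ ≤ (symmDiff S {i}).card + ({i} : Finset (Fin m)).card := Finset.card_union_le _ _
        _ = _ := by simp
    have h0' : t₀.depth < (symmDiff S {i}).card := by omega
    have h1' : t₁.depth < (symmDiff S {i}).card := by omega
    rw [cubeFourierCoeff_decisionTree_eq_zero φ t₀ S h0, cubeFourierCoeff_decisionTree_eq_zero φ t₁ S h1,
      cubeFourierCoeff_decisionTree_eq_zero φ t₀ _ h0', cubeFourierCoeff_decisionTree_eq_zero φ t₁ _ h1']
    ring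

/-- A function computed by a decision tree of depth `≤ D` has no Fourier tail above level `D`:
`W^{≥D+1} = 0`. [cite: Tal2017, Lemma 3.3] -/
theorem tailWeight_decisionTree_eq_zero (φ : Bool → ℝ) (T : DecisionTree m) {g : (Fin m → Bool) → ℝ}
    (hg : ∀ x, g x = φ (T.eval x)) {k : ℕ} (hk : T.depth < k) : tailWeight g k = 0 := by
  have : g = fun x => φ (T.eval x) := funext hg
  subst this
  refine Finset.sum_eq_zero fun S hS => ?_
  simp only [Finset.mem_filter, Finset.mem_univ, true_and] at hS
  rw [cubeFourierCoeff_decisionTree_eq_zero φ T S (by omega), zero_pow two_ne_zero]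


/-! ### Random restrictions: the LMN lemma (Tal 2017, Lemma 3.1) -/

section RandomRestriction

/-- The probability under `R_p` that the set of fixed variables is exactly `A`:
`(1-p)^{|A|} p^{m-|A|}`. [cite: Hastad1986, §2] -/
def subsetWeight (p : ℝ) (A : Finset (Fin m)) : ℝ := (1 - p) ^ A.card * p ^ (m - A.card)

/-- Subset weights are nonnegative for `p ∈ [0,1]`. [folklore] -/
theorem subsetWeight_nonneg {p : ℝ} (hp0 : 0 ≤ p) (hp1 : p ≤ 1) (A : Finset (Fin m)) : 0 ≤ subsetWeight p A := by
  unfold subsetWeight; have : 0 ≤ 1 - p := by linarith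
  positivity

/-- **Marginals of `R_p`**: the probability that all variables of `I` are free is `p^{|I|}`. [cite: Hastad1986, §2] -/
theorem sum_subsetWeight_disjoint (p : ℝ) (I : Finset (Fin m)) :
    ∑ A ∈ univ.filter (fun A : Finset (Fin m) => Disjoint I A), subsetWeight p A = p ^ I.card := by
  have hJ : univ.filter (fun A : Finset (Fin m) => Disjoint I A) = (univ \ I).powerset := by
    ext A
    simp only [Finset.mem_filter, Finset.mem_univ, true_and, Finset.mem_powerset, Finset.subset_sdiff,
      Finset.subset_univ, true_and]
    exact disjoint_comm
  rw [hJ]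
  have hcard : (univ \ I).card = m - I.card := by
    rw [Finset.card_sdiff_of_subset (Finset.subset_univ _), Finset.card_univ, Fintype.card_fin]
  have hIm : I.card ≤ m := by simpa using I.card_le_univ
  have key := Finset.sum_pow_mul_eq_add_pow (1 - p) p (univ \ I)
  rw [sub_add_cancel, one_pow, hcard] at key
  calc ∑ A ∈ (univ \ I).powerset, subsetWeight p A
      = ∑ A ∈ (univ \ I).powerset, p ^ I.card * ((1 - p) ^ A.card * p ^ (m - I.card - A.card)) := by
        refine Finset.sum_congr rfl fun A hA => ?_
        rw [Finset.mem_powerset] at hA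
        have hA' : A.card ≤ m - I.card := hcard ▸ Finset.card_le_card hA
        unfold subsetWeight
        rw [show m - A.card = I.card + (m - I.card - A.card) by omega, pow_add]; ring
    _ = p ^ I.card := by rw [← Finset.mul_sum, key, mul_one]

/-- `R_p` on subsets is a probability distribution. [cite: Hastad1986, §2] -/
theorem sum_subsetWeight (p : ℝ) : ∑ A : Finset (Fin m), subsetWeight p A = 1 := by
  have := sum_subsetWeight_disjoint p (∅ : Finset (Fin m))
  simpa using this

/-- The weight of `(A, v)` under `R_p` is the subset weight of `A` divided by `2^m`. [cite: Hastad1986, §2] -/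
theorem rrWeight_eq (p : ℝ) (σ : PAssign m) : rrWeight p σ = subsetWeight p σ.dom / 2 ^ m := rfl

/-- **Expected tail weight of a random restriction** (Tal 2017, Cor. 2.6 summed):
`𝔼_{ρ∼R_p} W^{≥j}[g|ρ] = ∑_S ĝ(S)² · Pr_ρ[|S ∩ stars(ρ)| ≥ j]`. [cite: Tal2017, Corollary 2.6] -/
theorem sum_rrWeight_tailWeight (g : (Fin m → Bool) → ℝ) (p : ℝ) (j : ℕ) :
    ∑ ρ : PAssign m, rrWeight p ρ * tailWeight (fun x => g (ρ.apply x)) j =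
      ∑ S, cubeFourierCoeff g S ^ 2 *
        ∑ A ∈ univ.filter (fun A : Finset (Fin m) => j ≤ (S \ A).card), subsetWeight p A := by
  rw [sum_PAssign]
  have hA : ∀ A : Finset (Fin m), ∑ v : Fin m → Bool, rrWeight p ⟨A, v⟩ * tailWeight (fun x => g ((⟨A, v⟩ : PAssign m).apply x)) j =
      subsetWeight p A * ∑ S ∈ univ.filter (fun S : Finset (Fin m) => j ≤ (S \ A).card), cubeFourierCoeff g S ^ 2 := by
    intro A
    simp only [rrWeight_eq]
    rw [← Finset.mul_sum]
    have : ∑ v : Fin m → Bool, tailWeight (fun x => g ((⟨A, v⟩ : PAssign m).apply x)) j =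
        ∑ v : Fin m → Bool, tailWeight (fun x => g (A.piecewise v x)) j := rfl
    rw [this, sum_tailWeight_piecewise]
    field_simp
  rw [Finset.sum_congr rfl fun A _ => hA A]
  calc ∑ A : Finset (Fin m), subsetWeight p A *
        ∑ S ∈ univ.filter (fun S : Finset (Fin m) => j ≤ (S \ A).card), cubeFourierCoeff g S ^ 2
      = ∑ A : Finset (Fin m), ∑ S : Finset (Fin m),
          (if j ≤ (S \ A).card then subsetWeight p A * cubeFourierCoeff g S ^ 2 else 0) := by
        refine Finset.sum_congr rfl fun A _ => ?_
        rw [Finset.sum_filter, Finset.mul_sum]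
        exact Finset.sum_congr rfl fun S _ => by split_ifs <;> simp
    _ = ∑ S : Finset (Fin m), ∑ A : Finset (Fin m),
          (if j ≤ (S \ A).card then subsetWeight p A * cubeFourierCoeff g S ^ 2 else 0) := Finset.sum_comm
    _ = _ := by
        refine Finset.sum_congr rfl fun S _ => ?_
        rw [Finset.sum_filter, Finset.mul_sum]
        exact Finset.sum_congr rfl fun A _ => by split_ifs <;> simp [mul_comm]

/-- **Tal 2017, Lemma 3.1** ([LMN93]) in threshold form: if for every `S` with `|S| ≥ k` the
probability that at least `j` variables of `S` stay free is `≥ 1/2`, then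
`W^{≥k}[g] ≤ 2 𝔼_{ρ∼R_p} W^{≥j}[g|ρ]`. [cite: Tal2017, Lemma 3.1] [cite: LinialMansourNisan1993, Lemma 7] -/
theorem tailWeight_le_two_mul_sum_rrWeight (g : (Fin m → Bool) → ℝ) {p : ℝ} (hp0 : 0 ≤ p) (hp1 : p ≤ 1)
    {j k : ℕ} (hprob : ∀ S : Finset (Fin m), k ≤ S.card →
      1 / 2 ≤ ∑ A ∈ univ.filter (fun A : Finset (Fin m) => j ≤ (S \ A).card), subsetWeight p A) :
    tailWeight g k ≤ 2 * ∑ ρ : PAssign m, rrWeight p ρ * tailWeight (fun x => g (ρ.apply x)) j := by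
  rw [sum_rrWeight_tailWeight, Finset.mul_sum]
  unfold tailWeight
  calc ∑ S ∈ univ.filter (fun S : Finset (Fin m) => k ≤ S.card), cubeFourierCoeff g S ^ 2
      ≤ ∑ S ∈ univ.filter (fun S : Finset (Fin m) => k ≤ S.card), 2 * (cubeFourierCoeff g S ^ 2 *
          ∑ A ∈ univ.filter (fun A : Finset (Fin m) => j ≤ (S \ A).card), subsetWeight p A) := by
        refine Finset.sum_le_sum fun S hS => ?_
        simp only [Finset.mem_filter, Finset.mem_univ, true_and] at hS
        have := hprob S hS
        nlinarith [sq_nonneg (cubeFourierCoeff g S)]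
    _ ≤ ∑ S, 2 * (cubeFourierCoeff g S ^ 2 *
          ∑ A ∈ univ.filter (fun A : Finset (Fin m) => j ≤ (S \ A).card), subsetWeight p A) := by
        refine Finset.sum_le_sum_of_subset_of_nonneg (Finset.subset_univ _) fun S _ _ => ?_
        refine mul_nonneg zero_le_two (mul_nonneg (sq_nonneg _) (Finset.sum_nonneg fun A _ => ?_))
        exact subsetWeight_nonneg hp0 hp1 A

/-! #### The number of free variables in a set: Chebyshev -/

/-- First moment: `𝔼 |S ∩ stars| = p |S|`. [folklore] -/
theorem sum_subsetWeight_card_sdiff (p : ℝ) (S : Finset (Fin m)) :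
    ∑ A : Finset (Fin m), subsetWeight p A * ((S \ A).card : ℝ) = p * S.card := by
  have hX : ∀ A : Finset (Fin m), ((S \ A).card : ℝ) = ∑ i ∈ S, if Disjoint ({i} : Finset (Fin m)) A then 1 else 0 := by
    intro A
    rw [Finset.sum_boole]
    congr 2; ext i; simp [Finset.mem_sdiff]
  simp_rw [hX, Finset.mul_sum, mul_ite, mul_one, mul_zero]
  rw [Finset.sum_comm]
  have : ∀ i ∈ S, ∑ A : Finset (Fin m), (if Disjoint ({i} : Finset (Fin m)) A then subsetWeight p A else 0) = p := by
    intro i _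
    rw [← Finset.sum_filter, sum_subsetWeight_disjoint]; simp
  rw [Finset.sum_congr rfl this]; simp [mul_comm]

/-- Second moment: `𝔼 |S ∩ stars|² = p|S| + p²|S|(|S|-1)`. [folklore] -/
theorem sum_subsetWeight_card_sdiff_sq (p : ℝ) (S : Finset (Fin m)) :
    ∑ A : Finset (Fin m), subsetWeight p A * ((S \ A).card : ℝ) ^ 2 = p * S.card + p ^ 2 * S.card * (S.card - 1) := by
  classical
  have hX : ∀ A : Finset (Fin m), ((S \ A).card : ℝ) = ∑ i ∈ S, if Disjoint ({i} : Finset (Fin m)) A then 1 else 0 := by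
    intro A
    rw [Finset.sum_boole]
    congr 2; ext i; simp [Finset.mem_sdiff]
  have hX2 : ∀ A : Finset (Fin m), ((S \ A).card : ℝ) ^ 2 =
      ∑ i ∈ S, ∑ i' ∈ S, if Disjoint ({i, i'} : Finset (Fin m)) A then 1 else 0 := by
    intro A
    rw [hX A, sq, Finset.sum_mul_sum]
    refine Finset.sum_congr rfl fun i _ => Finset.sum_congr rfl fun i' _ => ?_
    by_cases h1 : Disjoint ({i} : Finset (Fin m)) A <;> by_cases h2 : Disjoint ({i'} : Finset (Fin m)) A <;>
      simp_all [Finset.disjoint_insert_left]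
  simp_rw [hX2, Finset.mul_sum, mul_ite, mul_one, mul_zero]
  rw [Finset.sum_comm]
  simp_rw [Finset.sum_comm (s := (Finset.univ : Finset (Finset (Fin m)))) (t := S)]
  have inner : ∀ i ∈ S, ∀ i' ∈ S, ∑ A : Finset (Fin m),
      (if Disjoint ({i, i'} : Finset (Fin m)) A then subsetWeight p A else 0) = if i = i' then p else p ^ 2 := by
    intro i _ i' _
    rw [← Finset.sum_filter, sum_subsetWeight_disjoint]
    split_ifs with h
    · subst h; simp
    · rw [Finset.card_pair h]
  rw [Finset.sum_congr rfl fun i hi => Finset.sum_congr rfl fun i' hi' => inner i hi i' hi']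
  -- ∑_{i,i'∈S} (if i = i' then p else p²) = p s + p² s (s-1)
  have : ∀ i ∈ S, ∑ i' ∈ S, (if i = i' then p else p ^ 2) = p + p ^ 2 * (S.card - 1) := by
    intro i hi
    rw [← Finset.add_sum_erase S _ hi]
    simp only [if_true]
    congr 1
    rw [Finset.sum_congr rfl (g := fun _ => p ^ 2) fun i' hi' => by
      rw [if_neg (fun h => (Finset.mem_erase.1 hi').1 h.symm)]]
    rw [Finset.sum_const, Finset.card_erase_of_mem hi, nsmul_eq_mul]
    have : 1 ≤ S.card := Finset.card_pos.2 ⟨i, hi⟩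
    push_cast [this]; ring
  rw [Finset.sum_congr rfl this, Finset.sum_const, nsmul_eq_mul]; ring

/-- **Chebyshev for the number of free variables**: if `p|S| ≥ 8` and `j ≤ p|S|/2` then with
probability `≥ 1/2` at least `j` variables of `S` are free (in place of the median bound
`median Bin(ℓ, p) ≥ ⌊ℓp⌋` of [KB80] used by Tal). [cite: Tal2017, Lemma 3.1] -/
theorem half_le_sum_subsetWeight_free {p : ℝ} (hp0 : 0 ≤ p) (hp1 : p ≤ 1) (S : Finset (Fin m)) {j : ℕ}
    (hpS : 8 ≤ p * S.card) (hj : (j : ℝ) ≤ p * S.card / 2) :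
    1 / 2 ≤ ∑ A ∈ univ.filter (fun A : Finset (Fin m) => j ≤ (S \ A).card), subsetWeight p A := by
  set μ := p * S.card with hμ
  have hμpos : 0 < μ := by linarith
  -- the complementary probability is small by Chebyshev
  have hbad : ∑ A ∈ univ.filter (fun A : Finset (Fin m) => ¬ j ≤ (S \ A).card), subsetWeight p A ≤ 1 / 2 := by
    have hpt : ∀ A ∈ univ.filter (fun A : Finset (Fin m) => ¬ j ≤ (S \ A).card),
        subsetWeight p A ≤ subsetWeight p A * (((S \ A).card : ℝ) - μ) ^ 2 / (μ / 2) ^ 2 := by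
      intro A hA
      simp only [Finset.mem_filter, Finset.mem_univ, true_and, not_le] at hA
      have hw := subsetWeight_nonneg hp0 hp1 A
      have hX : ((S \ A).card : ℝ) < j := by exact_mod_cast hA
      have hdev : (μ / 2) ^ 2 ≤ (((S \ A).card : ℝ) - μ) ^ 2 := by nlinarith
      rw [le_div_iff₀ (by positivity)]
      nlinarith
    calc ∑ A ∈ univ.filter (fun A : Finset (Fin m) => ¬ j ≤ (S \ A).card), subsetWeight p A
        ≤ ∑ A ∈ univ.filter (fun A : Finset (Fin m) => ¬ j ≤ (S \ A).card),
            subsetWeight p A * (((S \ A).card : ℝ) - μ) ^ 2 / (μ / 2) ^ 2 := Finset.sum_le_sum hpt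
      _ ≤ ∑ A, subsetWeight p A * (((S \ A).card : ℝ) - μ) ^ 2 / (μ / 2) ^ 2 :=
          Finset.sum_le_sum_of_subset_of_nonneg (Finset.subset_univ _) fun A _ _ => by
            have := subsetWeight_nonneg hp0 hp1 A; positivity
      _ = (∑ A, subsetWeight p A * ((S \ A).card : ℝ) ^ 2 - 2 * μ * ∑ A, subsetWeight p A * ((S \ A).card : ℝ)
            + μ ^ 2 * ∑ A, subsetWeight p A) / (μ / 2) ^ 2 := by
          rw [← Finset.sum_div]
          congr 1
          rw [Finset.mul_sum, Finset.mul_sum, ← Finset.sum_sub_distrib, ← Finset.sum_add_distrib]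
          exact Finset.sum_congr rfl fun A _ => by ring
      _ = (p * S.card * (1 - p)) / (μ / 2) ^ 2 := by
          rw [sum_subsetWeight_card_sdiff_sq, sum_subsetWeight_card_sdiff, sum_subsetWeight, hμ]; ring
      _ = 4 * (1 - p) / μ := by rw [hμ]; field_simp; ring
      _ ≤ 4 / μ := by
          apply div_le_div_of_nonneg_right _ hμpos.le; linarith
      _ ≤ 1 / 2 := by rw [div_le_iff₀ hμpos]; linarith
  have htot := sum_subsetWeight (m := m) p
  rw [← Finset.sum_filter_add_sum_filter_not univ (fun A : Finset (Fin m) => j ≤ (S \ A).card)] at htot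
  linarith

end RandomRestriction


/-! ### From exponentially small tails to level-`k` spectral norms (Tal 2017, §4) -/

section SpectralNorm

/-- **Summing a function of the `T`-coordinates** (Mathlib's `DependsOn F ↑T`):
`∑_x F(x) = 2^{m-|T|} ∑_{a ∈ {0,1}^T} F(a)`, in the form: the sum is `2^{m-|T|}` times a sum of
values of `F`. [folklore] -/
theorem sum_eq_pow_mul_sum_of_dependsOn {F : (Fin m → Bool) → ℝ} {T : Finset (Fin m)}
    (hF : DependsOn F (↑T : Set (Fin m))) (b₀ : {i // ¬ i ∈ T} → Bool) :
    ∑ x, F x = 2 ^ (m - T.card) *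
      ∑ a : {i // i ∈ T} → Bool, F ((Equiv.piEquivPiSubtypeProd (fun i => i ∈ T) (fun _ => Bool)).symm (a, b₀)) := by
  set e := Equiv.piEquivPiSubtypeProd (fun i => i ∈ T) (fun _ : Fin m => Bool) with he
  rw [← Fintype.sum_equiv e.symm (fun q => F (e.symm q)) F (fun q => rfl), Fintype.sum_prod_type]
  rw [Finset.mul_sum]
  refine Finset.sum_congr rfl fun a _ => ?_
  have hconst : ∀ b : {i // ¬ i ∈ T} → Bool, F (e.symm (a, b)) = F (e.symm (a, b₀)) := by
    intro b
    refine hF fun i hi => ?_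
    have hi' : i ∈ T := Finset.mem_coe.1 hi
    simp [he, Equiv.piEquivPiSubtypeProd, hi']
  rw [Finset.sum_congr rfl fun b _ => hconst b, Finset.sum_const, Finset.card_univ, nsmul_eq_mul]
  congr 1
  rw [Fintype.card_fun, Fintype.card_bool, Fintype.card_subtype_compl, Fintype.card_fin]
  · push_cast
    congr 1
    rw [Fintype.card_subtype]; simp
  
/-- `sgn b` is an integer. [folklore] -/
theorem sgn_eq_intCast (b : Bool) : Literature.Probability.RandomGraphs.LowDegree.sgn b = ((if b then -1 else 1 : ℤ) : ℝ) := by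
  cases b <;> simp [Literature.Probability.RandomGraphs.LowDegree.sgn]

/-- A character takes integer values. [folklore] -/
theorem walsh_eq_intCast (T : Finset (Fin m)) (x : Fin m → Bool) :
    Literature.Probability.RandomGraphs.LowDegree.walsh T x = ((∏ i ∈ T, (if x i then -1 else 1 : ℤ)) : ℝ) := by
  rw [Literature.Probability.RandomGraphs.LowDegree.walsh]; push_cast
  exact Finset.prod_congr rfl fun i _ => by cases x i <;> simp [Literature.Probability.RandomGraphs.LowDegree.sgn]

/-- For an integer `z`, `|z| ≤ z²`. [folklore] -/
theorem abs_intCast_le_sq (z : ℤ) : |(z : ℝ)| ≤ (z : ℝ) ^ 2 := by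
  rcases eq_or_ne z 0 with rfl | hz
  · simp
  · have h1 : (1 : ℝ) ≤ |(z : ℝ)| := by
      rw [← Int.cast_abs]; exact_mod_cast Int.one_le_abs hz
    calc |(z : ℝ)| = |(z : ℝ)| * 1 := (mul_one _).symm
      _ ≤ |(z : ℝ)| * |(z : ℝ)| := mul_le_mul_of_nonneg_left h1 (abs_nonneg _)
      _ = (z : ℝ) ^ 2 := by rw [← abs_mul, ← sq, abs_sq]

/-- **Granularity** (Tal 2017, Fact 2.8 / proof of Lemma 4.5): the top coefficient `ĝ_y(T)` of
the restriction of a `{±1}`-valued `g` to the coordinates `T` (the others fixed to `y`) is an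
integer multiple of `2^{-|T|}`, hence `|ĝ_y(T)| ≤ 2^{|T|} ĝ_y(T)²`. [cite: Tal2017, Lemma 4.5] -/
theorem abs_coeff_restrict_le_sq (f : (Fin m → Bool) → Bool) (T : Finset (Fin m)) (y : Fin m → Bool) :
    |cubeFourierCoeff (fun x => Literature.Probability.RandomGraphs.LowDegree.sgn (f ((univ \ T).piecewise y x))) T| ≤
      2 ^ T.card * cubeFourierCoeff (fun x => Literature.Probability.RandomGraphs.LowDegree.sgn (f ((univ \ T).piecewise y x))) T ^ 2 := by
  set F : (Fin m → Bool) → ℝ := fun x => Literature.Probability.RandomGraphs.LowDegree.sgn (f ((univ \ T).piecewise y x)) * Literature.Probability.RandomGraphs.LowDegree.walsh T x with hFdef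
  have hF : DependsOn F (↑T : Set (Fin m)) := by
    intro x x' h
    have h' : ∀ i ∈ T, x i = x' i := fun i hi => h i (Finset.mem_coe.2 hi)
    have hpw : (univ \ T).piecewise y x = (univ \ T).piecewise y x' := by
      funext i
      by_cases hi : i ∈ T
      · simp [Finset.piecewise, hi, h' i hi]
      · simp [Finset.piecewise, hi]
    have hw : Literature.Probability.RandomGraphs.LowDegree.walsh T x = Literature.Probability.RandomGraphs.LowDegree.walsh T x' := Finset.prod_congr rfl fun i hi => by rw [h' i hi]
    simp only [hFdef, hpw, hw]
  have hTm : T.card ≤ m := by simpa using T.card_le_univ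
  by_cases hT : ∀ i, i ∈ T
  · -- `T = univ`: the coefficient is `K / 2^m` with `K` an integer and `|T| = m`
    have hTu : T = univ := Finset.eq_univ_iff_forall.2 hT
    obtain ⟨K, hK⟩ : ∃ K : ℤ, ∑ x, F x = K := by
      refine ⟨∑ x, (if f ((univ \ T).piecewise y x) then -1 else 1) * ∏ i ∈ T, (if x i then -1 else 1), ?_⟩
      push_cast
      refine Finset.sum_congr rfl fun x _ => ?_
      rw [hFdef]; simp only
      rw [sgn_eq_intCast, walsh_eq_intCast]; push_cast; rfl
    have hc : cubeFourierCoeff (fun x => Literature.Probability.RandomGraphs.LowDegree.sgn (f ((univ \ T).piecewise y x))) T = K / 2 ^ m := by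
      unfold cubeFourierCoeff; rw [← hK]
    rw [hc, hTu, Finset.card_univ, Fintype.card_fin, abs_div, abs_of_pos (by positivity : (0:ℝ) < 2 ^ m),
      div_pow, div_le_iff₀ (by positivity)]
    calc |(K : ℝ)| ≤ (K : ℝ) ^ 2 := abs_intCast_le_sq K
      _ = 2 ^ m * ((K : ℝ) ^ 2 / (2 ^ m) ^ 2) * 2 ^ m := by field_simp
  · push Not at hT
    obtain ⟨i₀, hi₀⟩ := hT
    let b₀ : {i // ¬ i ∈ T} → Bool := fun _ => false
    obtain ⟨K, hK⟩ : ∃ K : ℤ, ∑ a : {i // i ∈ T} → Bool,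
        F ((Equiv.piEquivPiSubtypeProd (fun i => i ∈ T) (fun _ => Bool)).symm (a, b₀)) = K := by
      refine ⟨∑ a : {i // i ∈ T} → Bool,
        (if f ((univ \ T).piecewise y ((Equiv.piEquivPiSubtypeProd (fun i => i ∈ T) (fun _ => Bool)).symm (a, b₀)))
          then -1 else 1) *
        ∏ i ∈ T, (if (Equiv.piEquivPiSubtypeProd (fun i => i ∈ T) (fun _ => Bool)).symm (a, b₀) i then -1 else 1), ?_⟩
      push_cast
      refine Finset.sum_congr rfl fun a _ => ?_
      rw [hFdef]; simp only
      rw [sgn_eq_intCast, walsh_eq_intCast]; push_cast; rfl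
    have hsum := sum_eq_pow_mul_sum_of_dependsOn hF b₀
    rw [hK] at hsum
    have hc : cubeFourierCoeff (fun x => Literature.Probability.RandomGraphs.LowDegree.sgn (f ((univ \ T).piecewise y x))) T = K / 2 ^ T.card := by
      unfold cubeFourierCoeff
      rw [show (∑ x, Literature.Probability.RandomGraphs.LowDegree.sgn (f ((univ \ T).piecewise y x)) * Literature.Probability.RandomGraphs.LowDegree.walsh T x) = ∑ x, F x from rfl, hsum]
      rw [show (2 : ℝ) ^ m = 2 ^ (m - T.card) * 2 ^ T.card by rw [← pow_add]; congr 1; omega]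
      field_simp
    rw [hc, abs_div, abs_of_pos (by positivity : (0:ℝ) < 2 ^ T.card), div_pow, div_le_iff₀ (by positivity)]
    calc |(K : ℝ)| ≤ (K : ℝ) ^ 2 := abs_intCast_le_sq K
      _ = 2 ^ T.card * ((K : ℝ) ^ 2 / (2 ^ T.card) ^ 2) * 2 ^ T.card := by field_simp

/-- **Tal 2017, Lemma 4.5**: for a `{±1}`-valued `g = χ ∘ f`,
`|ĝ(T)| ≤ 2^{|T|} ∑_{U ⊆ Tᶜ} ĝ(T ∪ U)² = 2^{|T|} Inf_T(f)`. [cite: Tal2017, Lemma 4.5] -/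
theorem abs_cubeFourierCoeff_le_pow_mul_sum (f : (Fin m → Bool) → Bool) (T : Finset (Fin m)) :
    |cubeFourierCoeff (fun x => Literature.Probability.RandomGraphs.LowDegree.sgn (f x)) T| ≤
      2 ^ T.card * ∑ U ∈ (univ \ T).powerset, cubeFourierCoeff (fun x => Literature.Probability.RandomGraphs.LowDegree.sgn (f x)) (T ∪ U) ^ 2 := by
  set g : (Fin m → Bool) → ℝ := fun x => Literature.Probability.RandomGraphs.LowDegree.sgn (f x) with hg
  have hdisj : Disjoint T (univ \ T) := Finset.disjoint_sdiff
  -- average of the restricted top coefficients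
  have havg : ∑ y : Fin m → Bool, cubeFourierCoeff (fun x => g ((univ \ T).piecewise y x)) T = 2 ^ m * cubeFourierCoeff g T := by
    simp_rw [cubeFourierCoeff_piecewise_eq_sum_powerset g (univ \ T) _ hdisj]
    rw [Finset.sum_comm]
    have : ∀ U ∈ (univ \ T).powerset, ∑ y : Fin m → Bool, cubeFourierCoeff g (T ∪ U) * Literature.Probability.RandomGraphs.LowDegree.walsh U y =
        if U = ∅ then 2 ^ m * cubeFourierCoeff g T else 0 := by
      intro U _
      rw [← Finset.mul_sum]
      have hw := sum_walsh_mul_walsh_index U (∅ : Finset (Fin m))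
      simp only [Literature.Probability.RandomGraphs.LowDegree.walsh_empty, mul_one] at hw
      rw [hw]
      split_ifs with hU
      · subst hU; simp [mul_comm]
      · simp
    rw [Finset.sum_congr rfl this, Finset.sum_ite_eq']
    simp
  have hsq := sum_sq_cubeFourierCoeff_piecewise g (univ \ T) hdisj
  have h2 : (0 : ℝ) < 2 ^ m := by positivity
  have key : |cubeFourierCoeff g T| * 2 ^ m ≤ (2 ^ T.card * ∑ U ∈ (univ \ T).powerset, cubeFourierCoeff g (T ∪ U) ^ 2) * 2 ^ m := by
    calc |cubeFourierCoeff g T| * 2 ^ m = |∑ y : Fin m → Bool, cubeFourierCoeff (fun x => g ((univ \ T).piecewise y x)) T| := by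
          rw [havg, abs_mul, abs_of_pos h2, mul_comm]
      _ ≤ ∑ y : Fin m → Bool, |cubeFourierCoeff (fun x => g ((univ \ T).piecewise y x)) T| :=
          Finset.abs_sum_le_sum_abs _ _
      _ ≤ ∑ y : Fin m → Bool, 2 ^ T.card * cubeFourierCoeff (fun x => g ((univ \ T).piecewise y x)) T ^ 2 :=
          Finset.sum_le_sum fun y _ => abs_coeff_restrict_le_sq f T y
      _ = (2 ^ T.card * ∑ U ∈ (univ \ T).powerset, cubeFourierCoeff g (T ∪ U) ^ 2) * 2 ^ m := by
          rw [← Finset.mul_sum, hsq]; ring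
  exact le_of_mul_le_mul_right key h2

/-- Reindexing `∑_{|T|=k} ∑_{U ⊆ Tᶜ} F(T ∪ U) = ∑_S C(|S|, k) F(S)`. [folklore] -/
theorem sum_powersetCard_sum_powerset_compl (k : ℕ) (F : Finset (Fin m) → ℝ) :
    ∑ T ∈ univ.powersetCard k, ∑ U ∈ (univ \ T).powerset, F (T ∪ U) = ∑ S, (S.card.choose k : ℝ) * F S := by
  have inner : ∀ T : Finset (Fin m), ∑ U ∈ (univ \ T).powerset, F (T ∪ U) =
      ∑ S ∈ univ.filter (fun S : Finset (Fin m) => T ⊆ S), F S := by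
    intro T
    refine Finset.sum_nbij' (fun U => T ∪ U) (fun S => S \ T) ?_ ?_ ?_ ?_ ?_
    · intro U _; simp
    · intro S _; simp
    · intro U hU
      rw [Finset.mem_powerset, Finset.subset_sdiff] at hU
      rw [Finset.union_sdiff_left]
      exact Finset.sdiff_eq_self_of_disjoint hU.2
    · intro S hS
      simp only [Finset.mem_filter, Finset.mem_univ, true_and] at hS
      exact Finset.union_sdiff_of_subset hS
    · intro U _; rfl
  simp_rw [inner, Finset.sum_filter]
  rw [Finset.sum_comm]
  refine Finset.sum_congr rfl fun S _ => ?_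
  rw [← Finset.sum_filter, Finset.sum_const]
  have : (univ.powersetCard k).filter (fun T : Finset (Fin m) => T ⊆ S) = S.powersetCard k := by
    ext T; simp [Finset.mem_powersetCard, and_comm]
  rw [this, Finset.card_powersetCard, nsmul_eq_mul]

/-- `L_{1,k}(g) ≤ 2^k ∑_S C(|S|,k) ĝ(S)² = 2^k Inf^k(f)` for `{±1}`-valued `g` (Tal 2017, Lemma 4.5
summed over `|T| = k`, with Claim 2.12). [cite: Tal2017, Lemma 4.5] -/
theorem l1Level_le_pow_mul_sum_choose (f : (Fin m → Bool) → Bool) (k : ℕ) :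
    l1Level (fun x => Literature.Probability.RandomGraphs.LowDegree.sgn (f x)) k ≤ 2 ^ k * ∑ S, (S.card.choose k : ℝ) * cubeFourierCoeff (fun x => Literature.Probability.RandomGraphs.LowDegree.sgn (f x)) S ^ 2 := by
  rw [← sum_powersetCard_sum_powerset_compl, Finset.mul_sum]
  refine Finset.sum_le_sum fun T hT => ?_
  rw [Finset.mem_powersetCard] at hT
  rw [← hT.2]
  exact abs_cubeFourierCoeff_le_pow_mul_sum f T

/-- The hockey-stick identity in the form `C(n, k) = ∑_{d<n} C(d, k-1)` (`k ≥ 1`). [folklore] -/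
theorem choose_eq_sum_range_choose {k : ℕ} (hk : 1 ≤ k) : ∀ n : ℕ,
    (n.choose k : ℝ) = ∑ d ∈ Finset.range n, (d.choose (k - 1) : ℝ)
  | 0 => by simp [Nat.choose_eq_zero_of_lt (by omega : 0 < k)]
  | n + 1 => by
    rw [Finset.sum_range_succ, ← choose_eq_sum_range_choose hk n]
    obtain ⟨k', rfl⟩ : ∃ k', k = k' + 1 := ⟨k - 1, by omega⟩
    rw [Nat.choose_succ_succ', Nat.add_sub_cancel]; push_cast; ring

/-- **Abel summation** (Tal 2017, Eq. (2) and Lemma 2.14): `∑_S C(|S|,k) ĝ(S)² = ∑_{d<m} C(d,k-1) W^{≥d+1}[g]`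
for `k ≥ 1`. [cite: Tal2017, Lemma 2.14] -/
theorem sum_choose_mul_sq_eq_sum_tailWeight (g : (Fin m → Bool) → ℝ) {k : ℕ} (hk : 1 ≤ k) :
    ∑ S, (S.card.choose k : ℝ) * cubeFourierCoeff g S ^ 2 =
      ∑ d ∈ Finset.range m, (d.choose (k - 1) : ℝ) * tailWeight g (d + 1) := by
  simp_rw [choose_eq_sum_range_choose hk, Finset.sum_mul]
  have : ∀ S : Finset (Fin m), ∑ d ∈ Finset.range S.card, (d.choose (k - 1) : ℝ) * cubeFourierCoeff g S ^ 2 =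
      ∑ d ∈ Finset.range m, if d + 1 ≤ S.card then (d.choose (k - 1) : ℝ) * cubeFourierCoeff g S ^ 2 else 0 := by
    intro S
    have hS : S.card ≤ m := by simpa using S.card_le_univ
    rw [← Finset.sum_filter]
    congr 1
    ext d; simp only [Finset.mem_range, Finset.mem_filter]; omega
  simp_rw [this]
  rw [Finset.sum_comm]
  refine Finset.sum_congr rfl fun d _ => ?_
  rw [tailWeight, Finset.mul_sum, Finset.sum_filter]

/-- The tail series: `∑_{d<m} C(d,k-1) a^{d+1} ≤ a^k / (1-a)^k` for `0 ≤ a < 1`, `k ≥ 1`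
(generalised binomial theorem, Tal 2017, Cor. 2.2). [cite: Tal2017, Corollary 2.2] -/
theorem sum_choose_mul_pow_le {a : ℝ} (ha0 : 0 ≤ a) (ha1 : a < 1) {k : ℕ} (hk : 1 ≤ k) (M : ℕ) :
    ∑ d ∈ Finset.range M, (d.choose (k - 1) : ℝ) * a ^ (d + 1) ≤ a ^ k / (1 - a) ^ k := by
  obtain ⟨k', rfl⟩ : ∃ k', k = k' + 1 := ⟨k - 1, by omega⟩
  simp only [Nat.add_sub_cancel]
  have hnorm : ‖a‖ < 1 := by rw [Real.norm_eq_abs, abs_of_nonneg ha0]; exact ha1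
  have hs := hasSum_choose_mul_geometric_of_norm_lt_one k' hnorm
  -- drop the vanishing terms `d < k'` and shift
  have hsplit : ∑ d ∈ Finset.range M, (d.choose k' : ℝ) * a ^ (d + 1) =
      ∑ n ∈ Finset.range (M - k'), ((n + k').choose k' : ℝ) * a ^ n * a ^ (k' + 1) := by
    rcases le_or_gt k' M with hkM | hkM
    · rw [← Finset.sum_range_add_sum_Ico _ hkM]
      rw [Finset.sum_eq_zero (fun d hd => by
        rw [Finset.mem_range] at hd
        rw [Nat.choose_eq_zero_of_lt hd]; simp), zero_add]
      rw [Finset.sum_Ico_eq_sum_range]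
      refine Finset.sum_congr rfl fun n _ => ?_
      rw [add_comm k' n, pow_add, pow_add]; ring
    · rw [show M - k' = 0 by omega, Finset.range_zero, Finset.sum_empty]
      refine Finset.sum_eq_zero fun d hd => ?_
      rw [Finset.mem_range] at hd
      rw [Nat.choose_eq_zero_of_lt (by omega)]; simp
  rw [hsplit, ← Finset.sum_mul]
  have hle : ∑ n ∈ Finset.range (M - k'), ((n + k').choose k' : ℝ) * a ^ n ≤ 1 / (1 - a) ^ (k' + 1) :=
    sum_le_hasSum _ (fun n _ => by positivity) hs
  calc (∑ n ∈ Finset.range (M - k'), ((n + k').choose k' : ℝ) * a ^ n) * a ^ (k' + 1)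
      ≤ 1 / (1 - a) ^ (k' + 1) * a ^ (k' + 1) := mul_le_mul_of_nonneg_right hle (by positivity)
    _ = a ^ (k' + 1) / (1 - a) ^ (k' + 1) := by ring

/-- `1/(e^{1/τ} - 1) ≤ τ`, i.e. `a/(1-a) ≤ τ` for `a = e^{-1/τ}` (Tal 2017, proof of Lemma 4.1:
`eˣ - 1 ≥ x`). [cite: Tal2017, Lemma 4.1] -/
theorem exp_ratio_le {τ : ℝ} (hτ : 0 < τ) :
    Real.exp (-(1 / τ)) / (1 - Real.exp (-(1 / τ))) ≤ τ := by
  have ha1 : Real.exp (-(1 / τ)) < 1 := Real.exp_lt_one_iff.2 (by rw [neg_lt_zero]; positivity)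
  have h1a : 0 < 1 - Real.exp (-(1 / τ)) := by linarith
  rw [div_le_iff₀ h1a]
  -- e^{1/τ} ≥ 1 + 1/τ, multiply by a = e^{-1/τ}: 1 ≥ a + a/τ
  have hexp : 1 + 1 / τ ≤ Real.exp (1 / τ) := by linarith [Real.add_one_le_exp (1 / τ)]
  have hprod : Real.exp (-(1 / τ)) * Real.exp (1 / τ) = 1 := by rw [← Real.exp_add]; simp
  have ha0 : 0 < Real.exp (-(1 / τ)) := Real.exp_pos _
  have : Real.exp (-(1 / τ)) * (1 + 1 / τ) ≤ 1 := by
    calc Real.exp (-(1 / τ)) * (1 + 1 / τ) ≤ Real.exp (-(1 / τ)) * Real.exp (1 / τ) :=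
          mul_le_mul_of_nonneg_left hexp ha0.le
      _ = 1 := hprod
  have key : Real.exp (-(1 / τ)) / τ ≤ 1 - Real.exp (-(1 / τ)) := by
    have e : Real.exp (-(1 / τ)) * (1 + 1 / τ) = Real.exp (-(1 / τ)) + Real.exp (-(1 / τ)) / τ := by ring
    linarith
  calc Real.exp (-(1 / τ)) = (Real.exp (-(1 / τ)) / τ) * τ := by field_simp
    _ ≤ (1 - Real.exp (-(1 / τ))) * τ := mul_le_mul_of_nonneg_right key hτ.le
    _ = τ * (1 - Real.exp (-(1 / τ))) := by ring

/-- **Exponentially small tails give bounded level-`k` spectral norms** (Tal 2017, §4: ESFT ⇒ InfK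
(Lemma 4.1) ⇒ L1 (Lemma 4.5)): if `g = χ ∘ f` is `{±1}`-valued and `W^{≥d}[g] ≤ C e^{-d/τ}` for all
`d`, then `L_{1,k}(g) ≤ C (2τ)^k` for every `k ≥ 1`. [cite: Tal2017, Lemma 4.1] [cite: Tal2017, Lemma 4.5] -/
theorem l1Level_le_of_tailWeight_le (f : (Fin m → Bool) → Bool) {C τ : ℝ} (hC : 0 ≤ C) (hτ : 0 < τ)
    (htail : ∀ d : ℕ, tailWeight (fun x => Literature.Probability.RandomGraphs.LowDegree.sgn (f x)) d ≤ C * Real.exp (-(d / τ))) {k : ℕ} (hk : 1 ≤ k) :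
    l1Level (fun x => Literature.Probability.RandomGraphs.LowDegree.sgn (f x)) k ≤ C * (2 * τ) ^ k := by
  set a := Real.exp (-(1 / τ)) with ha
  have ha0 : 0 ≤ a := (Real.exp_pos _).le
  have ha1 : a < 1 := Real.exp_lt_one_iff.2 (by rw [neg_lt_zero]; positivity)
  have hexp : ∀ d : ℕ, Real.exp (-(d / τ)) = a ^ d := by
    intro d
    rw [ha, ← Real.exp_nat_mul]; congr 1; ring
  calc l1Level (fun x => Literature.Probability.RandomGraphs.LowDegree.sgn (f x)) k
      ≤ 2 ^ k * ∑ S, (S.card.choose k : ℝ) * cubeFourierCoeff (fun x => Literature.Probability.RandomGraphs.LowDegree.sgn (f x)) S ^ 2 :=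
        l1Level_le_pow_mul_sum_choose f k
    _ = 2 ^ k * ∑ d ∈ Finset.range m, (d.choose (k - 1) : ℝ) * tailWeight (fun x => Literature.Probability.RandomGraphs.LowDegree.sgn (f x)) (d + 1) := by
        rw [sum_choose_mul_sq_eq_sum_tailWeight _ hk]
    _ ≤ 2 ^ k * ∑ d ∈ Finset.range m, (d.choose (k - 1) : ℝ) * (C * a ^ (d + 1)) := by
        refine mul_le_mul_of_nonneg_left (Finset.sum_le_sum fun d _ => ?_) (by positivity)
        refine mul_le_mul_of_nonneg_left ?_ (by positivity)
        have := htail (d + 1)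
        rwa [show ((d + 1 : ℕ) : ℝ) = (d : ℝ) + 1 by push_cast; ring, ← Nat.cast_add_one, hexp] at this
    _ = 2 ^ k * C * ∑ d ∈ Finset.range m, (d.choose (k - 1) : ℝ) * a ^ (d + 1) := by
        rw [mul_assoc]
        congr 1
        rw [Finset.mul_sum]
        exact Finset.sum_congr rfl fun d _ => by ring
    _ ≤ 2 ^ k * C * (a ^ k / (1 - a) ^ k) :=
        mul_le_mul_of_nonneg_left (sum_choose_mul_pow_le ha0 ha1 hk m) (by positivity)
    _ = C * (2 * (a / (1 - a))) ^ k := by rw [mul_pow, div_pow]; ring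
    _ ≤ C * (2 * τ) ^ k := by
        refine mul_le_mul_of_nonneg_left (pow_le_pow_left₀ (by
          have : 0 < 1 - a := by linarith
          positivity) ?_ _) hC
        exact mul_le_mul_of_nonneg_left (exp_ratio_le hτ) zero_le_two

/-- `L_{1,0}(g) = |ĝ(∅)| ≤ 1` for `|g| ≤ 1`. [cite: ODonnell2014, §1.2] -/
theorem l1Level_zero_le_one {g : (Fin m → Bool) → ℝ} (hg : ∀ x, |g x| ≤ 1) : l1Level g 0 ≤ 1 := by
  unfold l1Level
  rw [Finset.powersetCard_zero, Finset.sum_singleton]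
  exact abs_cubeFourierCoeff_le_one g hg ∅

end SpectralNorm

end Literature.Computability.Complexity.LowDegree

end
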